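import Summits.Schanuel.Schanuel.Theorems.RootDecomp1EUntwistedWall01

/-!
# RootDecomp1EUntwistedWall — lens 2, generation 41 «THE UNTWISTED 1-FOLD WALL BY TERM-COUNTING» (lane (P1) of critic RULING L1949 (5); GO + CHECKLIST E-g41 L1993; VERDICT L2040: CLEARED — ONE CELL (E-R18 (a″)) mod hE): `S` ITSELF with surplus one at the UNTWISTED twins `zTwin k β (q·ρ)` (`ρ` hyper-Liouville, `q ∈ ℚ^×`, `β ∈ ℚ(i) ∖ ℚ`, every `k ≥ 1`) and on the whole Gauss-curve class `InGaussCurveClass`, modulo the ONE registered published theorem `hE = EHLM2015_thm_2_1` (Ernvall-Hytönen–Leppälä–Matala-aho 2015, Thm 2.1, typed as a WEAKER few-term consequence over Gaussian-rational exponents) — «count TERMS, not DEGREE» — continuation (RootDecomp1EUntwistedWall02): §6 integrality (`IsZ`, `wden`, `isZ_expo`) + §7 sizes (`Wb`, `lacSize_lacForm_le` — polynomial in `den r`) + §8 `endgame`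

(lens-2 g41 HOME kernel UntwistedWall.lean 8d50f5c1…, 1431 l, import tree `RootDecomp1EWallDichotomy01` ONLY; Ctrl 1a8646c2… rc 1 at exactly nine lines C1–C9; Probe 491b1be0…; NODE-g41.md ab32189b…; NODE L2035 / REQUEST L2036 / ERRATUM L2037; writer re-check L2039; critic VERDICT L2040 (crit g8): CLEARED — ONE CELL (E-R18 (a″)) to lens-2, conditional «mod hE»; lens-2 tally cells ×3; RULE E-R19; PORT GO 01–0k `--supports stmt-Schanuel-31409`, statements/proofs verbatim, part 01 docstring of `EHLM2015_thm_2_1` amended by the critic's representation sentence and the `+1 → +2` exponent bookkeeping.)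
PORTED for the decomp-schanuel cell by the census instrument (gen 17), no census credit beyond the cell of record. Split in five parts for the 400-line cap (NODE §7 plan 01–04 with §1–§8 halved): 01 = §1 the registered fact `EHLM2015_thm_2_1` (the ONLY `def … : Prop` binder) + §2–§5 collapse data / identities / Lipschitz bound / distinct exponents and term count; 02 = §6–§8 integrality, sizes, endgame; 03 = §9 THE ENGINE `algebraicIndependent_gaussPt` (+ the kernel's module docstring); 04 = §10–§11 twins, the class `InGaussCurveClass`, the cells `cell_25020` / `cell_31409`, the member `z_U` and its separation from the point / scale / two-scale classes; 05 = §12–§13 the hypothesis-free Diophantine lemma `lambdaH_ne_pow_of_dyadicHyper₂`, `not_inLWClass_zU`, `zU_separation`, and the LIVE-item probes at `z_U`.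
PORT EDITS (statements and proofs otherwise VERBATIM): every undocumented helper received a one-line docstring; the tree-twin one-liners `isAlgebraic_I'`, `I_not_mem_range'`, `lambdaH_transcendental`, `lambdaH_ne_zero'`, `lambdaH_pos'`, `algebraicIndependent_tail'`, `abs_pow_succ_sub_le'` made `private` (copied privately into later parts where used); the two `Iff.rfl` READ-BACKS `defectOneSchanuel_iff` / `eStableDefectOne_iff` of K §13 are NOT re-landed (identical read-backs are already in the tree: `RootDecomp1EGenericScale05.defectOneSchanuel_iff` / `.eStableDefectOne_iff`); the positional probes `item25020_at_zU`, `item31409_at_zU`, `cell_25020_of_defectOneSchanuel`, `eStableDefectOne_at_zU (h : EStableDefectOne)`, `eStableDefectOne_body_at_zU_of_hE` are kept. Items 31409 / 25020 / 31410 stay OPEN (rung 0); nothing here proves `S`.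
-/

noncomputable section

open Complex Polynomial IntermediateField
open scoped BigOperators

open Summit.Schanuel.Schanuel.Theorems.RootDecomp1KHyper (SB SFset exists_ball_eval_ne_zero
  exists_int_mul_eq_map mvaeval_int_map sb_of_algebraicIndependent mem_adjoin_SFset_I')
open Summit.Schanuel.Schanuel.Theorems.RootDecomp1KHyper.HyperCell (HyperLiouville lambdaH
  hyperLiouville_lambdaH hexp one_le_hexp summable_lambdaH)
open Summit.Schanuel.Schanuel.Theorems.RootDecomp1ELWTransport (zTwin zTwin_left zTwin_right
  linearIndependent_zTwin dblMoments InLWClass DyadicHyper₂)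
open Summit.Schanuel.Schanuel.Theorems.RootDecomp1EScaleTransfer (InScaleClass HyperScaleApprox)
open Summit.Schanuel.Schanuel.Theorems.RootDecomp1ETwoScale (CoveredTower InTwoScaleClass)
open Summit.Schanuel.Schanuel.Theorems.RootDecomp1EPointTransfer (InPointClass lambdaH_rat_lower
  lambdaH_sub_rat_lower)
open Summit.Schanuel.Schanuel.Theorems.RootDecomp1EWallDichotomy (InTwistedFrameClass transcendental_complex
  transcendental_of_hyperLiouville not_linearIndependent_zTwin_ratCast twinExpo twinExpo_left twinExpo_right)
open Summit.Schanuel.Schanuel.Theorems.RootDecomp1BHyperFrame (trdeg_adjoin_le_of_isAlgebraic')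
open Summit.Schanuel.Schanuel.Theorems.RootDecomp1BDefectFloorCells (natCast_le_trdeg_of_algebraicIndependent)

namespace Summit.Schanuel.Schanuel.Theorems.RootDecomp1EUntwistedWall

variable {n : ℕ}

/-! ## §6  Integrality of the exponents: the common denominator `wden(w) · den(r)^{Σ e}` -/

/-- `q ∈ ℚ` is an integer. -/
def IsZ (q : ℚ) : Prop := ∃ z : ℤ, q = z

/-- `IsZ` is closed under addition. -/
theorem IsZ.add {a b : ℚ} (ha : IsZ a) (hb : IsZ b) : IsZ (a + b) := by
  obtain ⟨x, rfl⟩ := ha; obtain ⟨y, rfl⟩ := hb; exact ⟨x + y, by push_cast; ring⟩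

/-- `IsZ` is closed under multiplication. -/
theorem IsZ.mul {a b : ℚ} (ha : IsZ a) (hb : IsZ b) : IsZ (a * b) := by
  obtain ⟨x, rfl⟩ := ha; obtain ⟨y, rfl⟩ := hb; exact ⟨x * y, by push_cast; ring⟩

/-- Natural numbers are `IsZ`. -/
theorem IsZ.natCast (k : ℕ) : IsZ (k : ℚ) := ⟨k, by simp⟩

/-- `IsZ` is closed under finite sums. -/
theorem IsZ.sum {ι : Type*} (s : Finset ι) {f : ι → ℚ} (h : ∀ i ∈ s, IsZ (f i)) : IsZ (∑ i ∈ s, f i) := by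
  classical
  induction s using Finset.induction_on with
  | empty => exact ⟨0, by simp⟩
  | insert a s ha ih =>
    rw [Finset.sum_insert ha]
    exact (h a (Finset.mem_insert_self a s)).add (ih fun i hi => h i (Finset.mem_insert_of_mem hi))

/-- The common denominator of the Gaussian-rational coefficients `w_l`. -/
def wden (w : Fin n → ℚ × ℚ) : ℕ := ∏ l : Fin n, ((w l).1.den * (w l).2.den)

/-- The common weight denominator `wden w` is positive. -/
theorem wden_pos (w : Fin n → ℚ × ℚ) : 0 < wden w :=
  Finset.prod_pos fun l _ => Nat.mul_pos (w l).1.den_pos (w l).2.den_pos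

/-- If `den q ∣ d` then `d·q` is an integer. -/
theorem isZ_of_den_dvd {q : ℚ} {d : ℕ} (h : q.den ∣ d) : IsZ ((d : ℚ) * q) := by
  obtain ⟨c, hc⟩ := h
  refine ⟨c * q.num, ?_⟩
  rw [hc]; push_cast
  rw [mul_comm (q.den : ℚ) (c : ℚ), mul_assoc, Rat.den_mul_eq_num]

/-- `wden(w) · (w l).1` is an integer. -/
theorem isZ_wden_fst (w : Fin n → ℚ × ℚ) (l : Fin n) : IsZ ((wden w : ℚ) * (w l).1) :=
  isZ_of_den_dvd ((dvd_mul_right _ _).trans (Finset.dvd_prod_of_mem _ (Finset.mem_univ l)))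

/-- `wden(w) · (w l).2` is an integer. -/
theorem isZ_wden_snd (w : Fin n → ℚ × ℚ) (l : Fin n) : IsZ ((wden w : ℚ) * (w l).2) :=
  isZ_of_den_dvd ((dvd_mul_left _ _).trans (Finset.dvd_prod_of_mem _ (Finset.mem_univ l)))

/-- `den(r)^M · r^k` is an integer for `k ≤ M`. -/
theorem isZ_den_pow_mul_pow (r : ℚ) {k M : ℕ} (hk : k ≤ M) : IsZ ((r.den : ℚ) ^ M * r ^ k) := by
  refine ⟨r.num ^ k * (r.den : ℤ) ^ (M - k), ?_⟩
  have h1 : (r.den : ℚ) ^ k * r ^ k = (r.num : ℚ) ^ k := by rw [← mul_pow, Rat.den_mul_eq_num]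
  rw [show (r.den : ℚ) ^ M = (r.den : ℚ) ^ (M - k) * (r.den : ℚ) ^ k by
    rw [← pow_add, Nat.sub_add_cancel hk], mul_assoc, h1]
  push_cast; ring

/-- Each exponent is at most the sum of the exponents. -/
theorem le_esum (e : Fin n → ℕ) (l : Fin n) : e l ≤ ∑ l', e l' :=
  Finset.single_le_sum (f := e) (fun _ _ => Nat.zero_le _) (Finset.mem_univ l)

/-- `d · expo_s ∈ ℤ[i]` for `d = wden(w) · den(r)^{Σ_l e_l}`. -/
theorem isZ_expo (w : Fin n → ℚ × ℚ) (e : Fin n → ℕ) (r : ℚ) (s : Fin (n + 1) →₀ ℕ) :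
    IsZ (((wden w * r.den ^ (∑ l, e l) : ℕ) : ℚ) * (expo w e r s).1) ∧
      IsZ (((wden w * r.den ^ (∑ l, e l) : ℕ) : ℚ) * (expo w e r s).2) := by
  constructor
  · simp only [expo, Finset.mul_sum]
    refine IsZ.sum _ fun l _ => ?_
    have : ((wden w * r.den ^ (∑ l, e l) : ℕ) : ℚ) * ((s l.succ : ℚ) * (w l).1 * r ^ (e l)) =
        (s l.succ : ℚ) * (((wden w : ℚ) * (w l).1) * ((r.den : ℚ) ^ (∑ l, e l) * r ^ (e l))) := by
      push_cast; ring
    rw [this]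
    exact (IsZ.natCast _).mul ((isZ_wden_fst w l).mul (isZ_den_pow_mul_pow r (le_esum e l)))
  · simp only [expo, Finset.mul_sum]
    refine IsZ.sum _ fun l _ => ?_
    have : ((wden w * r.den ^ (∑ l, e l) : ℕ) : ℚ) * ((s l.succ : ℚ) * (w l).2 * r ^ (e l)) =
        (s l.succ : ℚ) * (((wden w : ℚ) * (w l).2) * ((r.den : ℚ) ^ (∑ l, e l) * r ^ (e l))) := by
      push_cast; ring
    rw [this]
    exact (IsZ.natCast _).mul ((isZ_wden_snd w l).mul (isZ_den_pow_mul_pow r (le_esum e l)))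

/-! ## §7  Sizes: the lacunary form has size polynomial in `den(r)` -/

/-- `Σ_l (|u_l| + |v_l|)·R^{e_l}` — bounds the exponents `|expo_s| ≤ D · Wb` when `|r| ≤ R`, `s_l ≤ D`. -/
def Wb (w : Fin n → ℚ × ℚ) (e : Fin n → ℕ) (R : ℝ) : ℝ :=
  ∑ l : Fin n, (|((w l).1 : ℝ)| + |((w l).2 : ℝ)|) * R ^ (e l)

/-- The weight bound `Wb w e R` is non-negative for `R ≥ 0`. -/
theorem Wb_nonneg (w : Fin n → ℚ × ℚ) (e : Fin n → ℕ) {R : ℝ} (hR : 0 ≤ R) : 0 ≤ Wb w e R :=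
  Finset.sum_nonneg fun l _ => by positivity

/-- Size of a collapsed exponent: both coordinates of `expo w e r s` are bounded by `D · Wb w e R` when `|r| ≤ R` and `s ≤ D`. -/
theorem abs_expo_le (w : Fin n → ℚ × ℚ) (e : Fin n → ℕ) {r : ℚ} {R : ℝ} (hR : |(r : ℝ)| ≤ R) {D : ℕ}
    {s : Fin (n + 1) →₀ ℕ} (hs : ∀ i, s i ≤ D) :
    |((expo w e r s).1 : ℝ)| + |((expo w e r s).2 : ℝ)| ≤ (D : ℝ) * Wb w e R := by
  have hrpow : ∀ k : ℕ, |(r : ℝ)| ^ k ≤ R ^ k := fun k => pow_le_pow_left₀ (abs_nonneg _) hR k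
  have h1 : ∀ (u : ℝ) (l : Fin n),
      |(s l.succ : ℝ) * u * (r : ℝ) ^ (e l)| ≤ (D : ℝ) * (|u| * R ^ (e l)) := by
    intro u l
    rw [abs_mul, abs_mul, abs_pow, Nat.abs_cast]
    have hsD : (s l.succ : ℝ) ≤ D := by exact_mod_cast hs l.succ
    calc (s l.succ : ℝ) * |u| * |(r : ℝ)| ^ (e l) ≤ (D : ℝ) * |u| * R ^ (e l) :=
          mul_le_mul (mul_le_mul_of_nonneg_right hsD (abs_nonneg u)) (hrpow (e l))
            (pow_nonneg (abs_nonneg _) _) (by positivity)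
      _ = (D : ℝ) * (|u| * R ^ (e l)) := by ring
  simp only [expo]
  push_cast
  calc |∑ l, (s l.succ : ℝ) * ((w l).1 : ℝ) * (r : ℝ) ^ (e l)|
        + |∑ l, (s l.succ : ℝ) * ((w l).2 : ℝ) * (r : ℝ) ^ (e l)|
      ≤ ∑ l, |(s l.succ : ℝ) * ((w l).1 : ℝ) * (r : ℝ) ^ (e l)|
        + ∑ l, |(s l.succ : ℝ) * ((w l).2 : ℝ) * (r : ℝ) ^ (e l)| :=
        add_le_add (Finset.abs_sum_le_sum_abs _ _) (Finset.abs_sum_le_sum_abs _ _)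
    _ ≤ ∑ l, (D : ℝ) * (|((w l).1 : ℝ)| * R ^ (e l)) + ∑ l, (D : ℝ) * (|((w l).2 : ℝ)| * R ^ (e l)) :=
        add_le_add (Finset.sum_le_sum fun l _ => h1 _ l) (Finset.sum_le_sum fun l _ => h1 _ l)
    _ = (D : ℝ) * Wb w e R := by
        rw [Wb, Finset.mul_sum, ← Finset.sum_add_distrib]
        exact Finset.sum_congr rfl fun l _ => by ring

/-- Size of a cleared coefficient: `|coef| ≤ den(r)^D · |P_s| · R^D`. -/
theorem abs_coef_le (P : MvPolynomial (Fin (n + 1)) ℤ) {D : ℕ} {r : ℚ} {R : ℝ} (hR1 : 1 ≤ R)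
    (hrR : |(r : ℝ)| ≤ R) {s : Fin (n + 1) →₀ ℕ} (hs : s 0 ≤ D) :
    |(coef P D r s : ℝ)| ≤ |((MvPolynomial.coeff s P : ℤ) : ℝ)| * (R ^ D * (r.den : ℝ) ^ D) := by
  have hnum : |(r.num : ℝ)| = |(r : ℝ)| * r.den := by
    have h : (r : ℝ) * r.den = r.num := by exact_mod_cast Rat.mul_den_eq_num r
    rw [← h, abs_mul, Nat.abs_cast]
  have h1 : |(r : ℝ)| ^ (s 0) ≤ R ^ D :=
    (pow_le_pow_left₀ (abs_nonneg _) hrR _).trans (pow_le_pow_right₀ hR1 hs)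
  have h2 : (r.den : ℝ) ^ (s 0) * (r.den : ℝ) ^ (D - s 0) = (r.den : ℝ) ^ D := by
    rw [← pow_add, Nat.add_sub_cancel' hs]
  have hc : (coef P D r s : ℝ) = ((MvPolynomial.coeff s P : ℤ) : ℝ) * (r.num : ℝ) ^ (s 0) *
      (r.den : ℝ) ^ (D - s 0) := by
    simp [coef]
  rw [hc, abs_mul, abs_mul, abs_pow, abs_pow, Nat.abs_cast, hnum, mul_pow]
  calc |((MvPolynomial.coeff s P : ℤ) : ℝ)| * (|(r : ℝ)| ^ (s 0) * (r.den : ℝ) ^ (s 0))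
        * (r.den : ℝ) ^ (D - s 0)
      = |((MvPolynomial.coeff s P : ℤ) : ℝ)| * (|(r : ℝ)| ^ (s 0) * (r.den : ℝ) ^ D) := by
        rw [← h2]; ring
    _ ≤ |((MvPolynomial.coeff s P : ℤ) : ℝ)| * (R ^ D * (r.den : ℝ) ^ D) := by gcongr

/-- Size of a coefficient of the lacunary form (sum of the cleared coefficients over a fibre). -/
theorem abs_lacForm_apply_le (P : MvPolynomial (Fin (n + 1)) ℤ) (D : ℕ) (w : Fin n → ℚ × ℚ)
    (e : Fin n → ℕ) (r : ℚ) (γ : ℚ × ℚ) :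
    |((lacForm P D w e r γ : ℤ) : ℝ)| ≤ ∑ s ∈ P.support, |(coef P D r s : ℝ)| := by
  classical
  rw [lacForm, Finsupp.finsetSum_apply]
  push_cast
  refine (Finset.abs_sum_le_sum_abs _ _).trans (Finset.sum_le_sum fun s _ => ?_)
  rw [Finsupp.single_apply]
  split_ifs <;> simp

/-- **Size bound.** `lacSize(Λ_r, d) ≤ 2 + d + #supp P · (D·Wb + (Σ|coeff|)·R^D·den(r)^D)`. -/
theorem lacSize_lacForm_le (P : MvPolynomial (Fin (n + 1)) ℤ) {D : ℕ}
    (hD : ∀ s ∈ P.support, ∀ i, s i ≤ D) (w : Fin n → ℚ × ℚ) (e : Fin n → ℕ) (r : ℚ) {R : ℝ}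
    (hR1 : 1 ≤ R) (hrR : |(r : ℝ)| ≤ R) (d : ℕ) :
    lacSize (lacForm P D w e r) d ≤ 2 + d + P.support.card *
      ((D : ℝ) * Wb w e R +
        (∑ s ∈ P.support, |((MvPolynomial.coeff s P : ℤ) : ℝ)|) * (R ^ D * (r.den : ℝ) ^ D)) := by
  classical
  have hR0 : 0 ≤ R := zero_le_one.trans hR1
  set G : ℝ := (D : ℝ) * Wb w e R with hG
  set Cf : ℝ := (∑ s ∈ P.support, |((MvPolynomial.coeff s P : ℤ) : ℝ)|) * (R ^ D * (r.den : ℝ) ^ D)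
    with hCf
  have hGγ : ∀ γ ∈ (lacForm P D w e r).support, |(γ.1 : ℝ)| + |(γ.2 : ℝ)| ≤ G := by
    intro γ hγ
    obtain ⟨s, hs, rfl⟩ := Finset.mem_image.mp (support_lacForm_subset P D w e r hγ)
    exact abs_expo_le w e hrR (hD s hs)
  have hCfγ : ∀ γ, |((lacForm P D w e r γ : ℤ) : ℝ)| ≤ Cf := by
    intro γ
    refine (abs_lacForm_apply_le P D w e r γ).trans ?_
    rw [hCf, Finset.sum_mul]
    exact Finset.sum_le_sum fun s hs => abs_coef_le P hR1 hrR (hD s hs 0)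
  have hsum : ∑ γ ∈ (lacForm P D w e r).support,
      (|(γ.1 : ℝ)| + |(γ.2 : ℝ)| + |((lacForm P D w e r γ : ℤ) : ℝ)|)
        ≤ (lacForm P D w e r).support.card * (G + Cf) := by
    rw [← nsmul_eq_mul, ← Finset.sum_const]
    exact Finset.sum_le_sum fun γ hγ => by linarith [hGγ γ hγ, hCfγ γ]
  have hcard : ((lacForm P D w e r).support.card : ℝ) ≤ P.support.card := by
    exact_mod_cast card_support_lacForm_le P D w e r
  have hG0 : 0 ≤ G := by rw [hG]; exact mul_nonneg (Nat.cast_nonneg D) (Wb_nonneg w e hR0)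
  have hCf0 : 0 ≤ Cf := by rw [hCf]; positivity
  have hprod : ((lacForm P D w e r).support.card : ℝ) * (G + Cf) ≤ P.support.card * (G + Cf) :=
    mul_le_mul_of_nonneg_right hcard (by linarith)
  unfold lacSize
  linarith

/-! ## §8  The endgame inequality -/

/-- `exp(−C₁^κ N^{K₁κ}) ≤ N^D·M·η`, `η < exp(−N^m)` and `A·N^{K₁κ+1} < N^m` (`A ≥ C₁^κ + D + M`) are
incompatible. -/
theorem endgame {N : ℝ} {m κ K₁ D : ℕ} {C₁ M η A : ℝ} (hN : 2 ≤ N) (hC₁ : 0 ≤ C₁) (hM : 0 < M)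
    (hηlt : η < Real.exp (-(N ^ m))) (hA : C₁ ^ κ + D + M ≤ A)
    (hgrow : A * N ^ (K₁ * κ + 1) < N ^ m)
    (hle : Real.exp (-(C₁ ^ κ * N ^ (K₁ * κ))) ≤ N ^ D * M * η) : False := by
  have hN0 : 0 < N := by linarith
  have hNDM : 0 < N ^ D * M := by positivity
  have h1 : Real.exp (-(C₁ ^ κ * N ^ (K₁ * κ))) < N ^ D * M * Real.exp (-(N ^ m)) :=
    hle.trans_lt (mul_lt_mul_of_pos_left hηlt hNDM)
  have h2 := Real.log_lt_log (Real.exp_pos _) h1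
  rw [Real.log_exp, Real.log_mul hNDM.ne' (Real.exp_pos _).ne', Real.log_exp,
    Real.log_mul (by positivity) hM.ne', Real.log_pow] at h2
  have hlogN : Real.log N ≤ N := (Real.log_le_sub_one_of_pos hN0).trans (by linarith)
  have hlogM : Real.log M ≤ M := (Real.log_le_sub_one_of_pos hM).trans (by linarith)
  have hK0 : 1 ≤ N ^ (K₁ * κ + 1) := one_le_pow₀ (by linarith)
  have hK1 : N ^ (K₁ * κ) ≤ N ^ (K₁ * κ + 1) := pow_le_pow_right₀ (by linarith) (Nat.le_succ _)
  have hK2 : N ≤ N ^ (K₁ * κ + 1) := le_self_pow₀ (by linarith) (Nat.succ_ne_zero _)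
  have hD0 : (0 : ℝ) ≤ D := Nat.cast_nonneg D
  have hCκ : 0 ≤ C₁ ^ κ := pow_nonneg hC₁ κ
  have a1 : C₁ ^ κ * N ^ (K₁ * κ) ≤ C₁ ^ κ * N ^ (K₁ * κ + 1) := mul_le_mul_of_nonneg_left hK1 hCκ
  have a2 : (D : ℝ) * Real.log N ≤ D * N ^ (K₁ * κ + 1) :=
    mul_le_mul_of_nonneg_left (hlogN.trans hK2) hD0
  have a3 : Real.log M ≤ M * N ^ (K₁ * κ + 1) := hlogM.trans (le_mul_of_one_le_right hM.le hK0)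
  have a4 : (C₁ ^ κ + D + M) * N ^ (K₁ * κ + 1) ≤ A * N ^ (K₁ * κ + 1) :=
    mul_le_mul_of_nonneg_right hA (by positivity)
  nlinarith [a1, a2, a3, a4, h2, hgrow]

end Summit.Schanuel.Schanuel.Theorems.RootDecomp1EUntwistedWall
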